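import Mathlib.Data.ZMod.Basic
import Mathlib.Algebra.CharP.Two
import Mathlib.Algebra.BigOperators.Ring.Finset
import Mathlib.Tactic.Ring

/-!
# Crux `CubicForrelation.NearExactIsExact` (stmt-QuantumAdvantage-14043) — transported 3-tensors stay symmetric and alternating

Certificate seat `b2b-cforr-cert` (gen 40).  HONEST FRAMING: kernel-checked index bookkeeping over `𝔽₂` (standard axioms, Mathlib only).
Companion of `tps_pair_covariant` (…TwelvePartnerSymplectic) and `tct_third_comp_coord` (…CubicFormTransport) in the Lean roadmap for
`E1280-even` (HOME/b2b-cforr-cert-g40/LEAN-PLAN-E1280-EVEN.md): after a change of frame the 3-vector `c'_{pjk} = Σ Pi_{pq}Pi_{ja}Pi_{kb} c_{qab}`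
and the 3-form `d'_{φjk} = Σ P_{ψφ}P_{aj}P_{bk} d_{ψab}` inherit the symmetry and the vanishing diagonals that the leaf files `tpa_R2_*` /
`tpa_R4_*` (cert seat g39) take as hypotheses `hcs, hcc, hds, hdc, hdd`.  Nothing about `θ₁₂`; NOT summit progress.

* `tcx_transport_symm23`, `tcx_transport_symm12`: symmetry in the last two / first two indices is preserved.
* `tcx_transport_diag`: over `𝔽₂`, a symmetric tensor with vanishing diagonal `t_{qaa} = 0` transports to one with vanishing diagonal.

References: folklore multilinear algebra.  Axioms: the standard three.
-/

set_option linter.dupNamespace false -- D-0017: single-problem summit ⇒ `QuantumAdvantage.QuantumAdvantage` by design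

namespace Summit.QuantumAdvantage.QuantumAdvantage.Theorems.CubicForrelation.NearExactIsExact

open Finset

variable {n m : ℕ} {R : Type*} [CommRing R]

/-- **Symmetry in the last two indices is preserved by transport.** [folklore] -/
theorem tcx_transport_symm23 (t : Fin n → Fin n → Fin n → R) (Q : Fin m → Fin n → R) (ht : ∀ q a b, t q b a = t q a b)
    (p j k : Fin m) :
    (∑ q, ∑ a, ∑ b, Q p q * Q k a * Q j b * t q a b) = ∑ q, ∑ a, ∑ b, Q p q * Q j a * Q k b * t q a b := by
  refine sum_congr rfl fun q _ => ?_
  rw [sum_comm]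
  refine sum_congr rfl fun a _ => sum_congr rfl fun b _ => ?_
  rw [ht q a b]; ring

/-- **Symmetry in the first two indices is preserved by transport.** [folklore] -/
theorem tcx_transport_symm12 (t : Fin n → Fin n → Fin n → R) (Q : Fin m → Fin n → R) (ht : ∀ q a b, t a q b = t q a b)
    (p j k : Fin m) :
    (∑ q, ∑ a, ∑ b, Q j q * Q p a * Q k b * t q a b) = ∑ q, ∑ a, ∑ b, Q p q * Q j a * Q k b * t q a b := by
  rw [sum_comm]
  refine sum_congr rfl fun q _ => sum_congr rfl fun a _ => sum_congr rfl fun b _ => ?_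
  rw [ht q a b]; ring

/-- **Vanishing diagonals are preserved by transport over `𝔽₂`.**  If `t_{q··}` is symmetric with `t_{qaa} = 0` then
`Σ_{q,a,b} Q_{pq} Q_{ja} Q_{jb} t_{qab} = 0` (the terms `(a,b)` and `(b,a)` cancel in characteristic two). [folklore] -/
theorem tcx_transport_diag (t : Fin n → Fin n → Fin n → ZMod 2) (Q : Fin m → Fin n → ZMod 2) (ht : ∀ q a b, t q b a = t q a b)
    (hd : ∀ q a, t q a a = 0) (p j : Fin m) :
    (∑ q, ∑ a, ∑ b, Q p q * Q j a * Q j b * t q a b) = 0 := by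
  refine sum_eq_zero fun q _ => ?_
  rw [← sum_product' (s := univ) (t := univ) (f := fun a b => Q p q * Q j a * Q j b * t q a b)]
  refine sum_involution (fun x _ => (x.2, x.1)) ?_ ?_ ?_ ?_
  · intro x _
    have : Q p q * Q j x.2 * Q j x.1 * t q x.2 x.1 = Q p q * Q j x.1 * Q j x.2 * t q x.1 x.2 := by rw [ht q x.1 x.2]; ring
    rw [this]
    exact CharTwo.add_self_eq_zero _
  · rintro ⟨a, b⟩ _ hne
    simp only [ne_eq, Prod.mk.injEq, not_and]
    intro hab
    subst hab
    exact absurd (by rw [hd]; ring) hne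
  · intro x _
    exact mem_product.mpr ⟨mem_univ _, mem_univ _⟩
  · intro x _
    rfl

/-- **All hypotheses at once.**  A totally symmetric tensor with vanishing diagonals transports (by any `Q : 𝔽₂^{m×n}`) to a totally
symmetric tensor with vanishing diagonals — the shape of the hypotheses `hcs/hcc/hcd` (3-vector, `Q = Pi`) and `hds/hdc/hdd`
(3-form, `Q = Pᵀ`) of the leaf files. [folklore] -/
theorem tcx_transport_hyps (t : Fin n → Fin n → Fin n → ZMod 2) (Q : Fin m → Fin n → ZMod 2)
    (hs : ∀ q a b, t q b a = t q a b) (hc : ∀ q a b, t a q b = t q a b) (hd : ∀ q a, t q a a = 0) :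
    (∀ p j k : Fin m, (∑ q, ∑ a, ∑ b, Q p q * Q k a * Q j b * t q a b) = ∑ q, ∑ a, ∑ b, Q p q * Q j a * Q k b * t q a b) ∧
    (∀ p j k : Fin m, (∑ q, ∑ a, ∑ b, Q j q * Q p a * Q k b * t q a b) = ∑ q, ∑ a, ∑ b, Q p q * Q j a * Q k b * t q a b) ∧
    (∀ p j : Fin m, (∑ q, ∑ a, ∑ b, Q p q * Q j a * Q j b * t q a b) = 0) :=
  ⟨fun p j k => tcx_transport_symm23 t Q hs p j k, fun p j k => tcx_transport_symm12 t Q hc p j k,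
    fun p j => tcx_transport_diag t Q hs hd p j⟩

/-- The 3-form transport of `tct_third_comp_coord` / `tps_pair_covariant` is written with the matrix `P` on the left
(`Σ P_{ψφ} P_{aj} P_{bk} d_{ψab}`); this is the `Q = Pᵀ` instance of the lemmas above. [folklore] -/
theorem tcx_transport_hyps_form (d : Fin n → Fin n → Fin n → ZMod 2) (P : Fin n → Fin m → ZMod 2)
    (hs : ∀ ψ a b, d ψ b a = d ψ a b) (hc : ∀ ψ a b, d a ψ b = d ψ a b) (hd : ∀ ψ a, d ψ a a = 0) :
    (∀ φ j k : Fin m, (∑ ψ, ∑ a, ∑ b, P ψ φ * P a k * P b j * d ψ a b) = ∑ ψ, ∑ a, ∑ b, P ψ φ * P a j * P b k * d ψ a b) ∧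
    (∀ φ j k : Fin m, (∑ ψ, ∑ a, ∑ b, P ψ j * P a φ * P b k * d ψ a b) = ∑ ψ, ∑ a, ∑ b, P ψ φ * P a j * P b k * d ψ a b) ∧
    (∀ φ j : Fin m, (∑ ψ, ∑ a, ∑ b, P ψ φ * P a j * P b j * d ψ a b) = 0) :=
  tcx_transport_hyps d (fun i l => P l i) hs hc hd

end Summit.QuantumAdvantage.QuantumAdvantage.Theorems.CubicForrelation.NearExactIsExact
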